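import Summits.ABC.IUTFork.Cor312PinnedIdentified
import HarnessLib

/-!
# [IUTchIII] Cor. 3.12 under the PINS, III: the pinned FORK over one contentful instance of the typed Theorem 3.11

Record-only file (D-0012) of the abc-iut cell (PINNED-REGIONS ROUND of director-abc 2026-08-26T01:56:18Z / 03:07:33Z;
`HOME/plan/ADJUDICATION-SPEC.md` v2.3 (G-PINNED)/(G-PINNED-2); seat abc-iut-w5-d247, gen 2; part III of III, parts I–II =
`Cor312PinnedQDatum` / `Cor312PinnedIdentified`); TAKES NO SIDE on [IUTchIII] Cor. 3.12; PROOF-ONLY, no definition, no `Prop`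
fact.  It ASSEMBLES, by name, the two pinned settings of part II over abc-iut-w5-d247's CONTENTFUL `naiveFull 2` and
abc-iut-w5-d230's honest operator `ballOfMonoid` — P♯ (q-datum honest, `honestQSetting`) and P♭ (q-datum link-identified,
`linkIdSetting`) — into ONE statement, the pinned sequel of `cor312_fork_over_contentful_thm311` (p416706):

* §1 volumes: `−|log(Θ)|(P♯) = stepVWeight·(−|log(q)|(P♯))` (`honestQ_encodes`); the so-pinned «`−|log(q)|`» of P♭ IS the
  Θ-volume and equals `stepVWeight ×` the honest q-volume of P♯ (`linkId_negLogQ_eq_weight_mul`: identifying the q-pilot's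
  datum with the Θ-monoid multiplies `−|log(q)|` by the Step-(v) weight `(l⋇+1)(2l⋇+1)/6 = 5/2`); UNIQUENESS at region level:
  every identified ∧ Θ-pinned naive setting has P♭'s q-regions (`qRegion_eq_linkId_of_identified_of_thetaPinned`).
* §2 `cor312_pinned_fork_over_contentful_thm311`: ∃ ONE index, ONE contentful `F` (typed Thm. 3.11 (i) ∧ (ii) ∧ (iii) + census),
  ONE ⟨(Ind1)∪(Ind2)⟩-equivariant monoid-dependent `ρ`, two settings with the SAME column, hull frames and Θ-glue (`rfl`), BOTH
  carrying ALL THREE PINS ((pΘ),(pq′),(pL)) and every bridge hypothesis and `|log(q)| > 0`, differing ONLY in the bad-place datum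
  the q-pilot carries through the link: P♯ — `¬PilotKummerIndRelated`, `¬GapA″`, Corollary FALSE, identified reading FALSE; P♭ —
  `hlink`, `PilotKummerIndRelated`, `GapA″`, Corollary TRUE (attained), identified reading TRUE; `−|log(q)|(P♭) = stepVWeight ·
  (−|log(q)|(P♯))`, `−|log(Θ)|(P♭) = −|log(Θ)|(P♯)`.  Compact form `pins_do_not_decide_gapA''`.  So with both regions pinned as
  in the Corollary's own statement and the pilot law pinned at the object level, the typed premises do not decide the residual;
  ONE datum does, and under the pins «identifying the copies» ([cite: ScholzeStix2018, §2.2 pp. 9–10]) can only mean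
  identifying THAT datum with the Θ-monoid — print's hedged (xi-e)/(xi-f), [IUTchIII] p. 183 l. 43 – p. 184 l. 29.
* RELATION TO THE COUNTERMODEL OF RECORD: abc-iut-w4-d101's object-honest `PinnedWitness.pinned_countermodel` /
  `pinned_fork` (p419720) give the P♯-branch with honest pilot OBJECTS (operator `orbitRegion`); this file's fork is the
  two-DATA form over one constructor (both branches pin-respecting, same operator), with the volume relation and uniqueness.
HONEST SCOPE: interface/toy level; nothing about the intended situation; no judgement on print. [claim: Mochizuki2012, status: disputed]
-/

noncomputable section

namespace Summit.ABC

namespace IUTFork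

namespace Cor312Vol

namespace NaiveWitness

open Thm311 Cor312 Cor312.Checks Cor312.IdentifiedNonVacuity Literature.IUT.LogThetaLattice GluedMonoids.Naive

variable (p : ℕ)

/-! ## 1. Volumes and uniqueness -/

section Volumes

variable [hp : Fact p.Prime]

/-- P♯: `−|log(Θ)| = stepVWeight · (−|log(q)|)` with the Step-(v) weight `(l⋇+1)(2l⋇+1)/6 = 5/2 > 1` of Team R's
`Cor312IdentifiedCopies` (via abc-iut-w5-d247's `naiveSetting_encodes`). [folklore] -/
theorem honestQ_encodes :
    (honestQSetting p).negLogTheta = ((stepVWeight toyIndex * (honestQSetting p).negLogQ : ℝ) : WithTop ℝ) := by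
  rw [show (honestQSetting p).negLogTheta = _ from withQDatum_negLogTheta_eq_naive p _ (qDatum_hul p),
    naiveSetting_encodes, honestQ_negLogQ, naiveSetting_negLogQ]


/-- **The pinned-identified «q-volume» of P♭ IS the Θ-volume of the natural glue** (`−(5/2)·log p`). [folklore] -/
theorem linkId_negLogQ_eq_naive_negLogTheta :
    (((linkIdSetting p).negLogQ : ℝ) : WithTop ℝ) = (naiveSetting p).negLogTheta := by
  rw [linkId_negLogQ, naiveSetting_negLogTheta]

/-- **… = `stepVWeight ×` the HONEST q-volume of P♯** (`(5/2)·(−log p)`): identifying the q-pilot's datum with the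
Θ-monoid multiplies `−|log(q)|` by the Step-(v) weight `(l⋇+1)(2l⋇+1)/6`. [folklore] -/
theorem linkId_negLogQ_eq_weight_mul :
    (linkIdSetting p).negLogQ = stepVWeight toyIndex * (honestQSetting p).negLogQ := by
  have h : (((linkIdSetting p).negLogQ : ℝ) : WithTop ℝ) =
      ((stepVWeight toyIndex * (naiveSetting p).negLogQ : ℝ) : WithTop ℝ) := by
    rw [linkId_negLogQ_eq_naive_negLogTheta, naiveSetting_encodes]
  rw [honestQ_negLogQ, ← naiveSetting_negLogQ]
  exact WithTop.coe_injective h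

/-- **UNIQUENESS at region level**: over the naive model with the honest operator, EVERY setting satisfying Team R's
`IdentifiedReading` and the Θ-pin has P♭'s q-pilot regions. [folklore] -/
theorem qRegion_eq_linkId_of_identified_of_thetaPinned (P : Setting (naiveSituation p))
    (hId : P.IdentifiedReading) (hΘ : ThetaPinned (naiveFull p).toLatticeSituation P (ballOfMonoid p))
    (j : toyIndex.Label) (vQ : toyIndex.VQ) : P.qRegion j vQ = (linkIdSetting p).qRegion j vQ := by
  rw [qRegion_eq_pBall_jsq_of_identified_of_thetaPinned p P hId hΘ, linkId_qRegion]


/-- P♯ does NOT satisfy Team R's `IdentifiedReading` (`B_4 ≠ B_1` at `j = 2`). [folklore] -/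
theorem honestQ_not_identifiedReading : ¬ (honestQSetting p).IdentifiedReading := fun hId =>
  honestQ_not_reading3 p fun j vQ => by
    rw [hId.possibleImages_eq]; exact Set.mem_singleton _

end Volumes

/-! ## 2. The PINNED FORK over one contentful instance of the typed Theorem 3.11 -/

/-- **THE PINNED FORK ([IUTchIII] Cor. 3.12; ADJUDICATION-SPEC v2.2 §2 (G-PINNED)).**  There are ONE index skeleton,
ONE full situation satisfying the typed Theorem 3.11 (i) ∧ (ii) ∧ (iii) CONTENTFULLY (nonempty zero-free splitting
monoids, nonempty number-field copies, the `m' = 1` unit image strictly inside the shell, non-identity theater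
automorphisms, a non-trivially acting (Ind1),(Ind2)-group), ONE region operator `ρ` which is
⟨(Ind1)∪(Ind2)⟩-EQUIVARIANT and MONOID-DEPENDENT, and two settings `P♯`, `P♭` with the SAME column, hull frames
and Θ-pilot Kummer images, BOTH carrying ALL THREE PINS (`PinnedRegions3`: the two region pins of the Corollary's own statement
and the object-level pilot law of the Θ×μ_LGP-link) for the same `ρ` and two bad-place q-data, BOTH satisfying every bridge hypothesis and `|log(q)| > 0`, such that:
`P♯` (q-datum the honest `{(±q)_j}`): `¬PilotKummerIndRelated`, `¬GapA″`, the typed Corollary FAILS, the identified-copies reading FAILS,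
`−|log(Θ)| = stepVWeight·(−|log(q)|)`; `P♭` (q-datum `{(±q^{j²})_j}` = the Θ-monoid, satisfying PR-1's `hlink`):
`PilotKummerIndRelated`, `GapA″`, the typed Corollary HOLDS with `−|log(Θ)| = −|log(q)|` attained, the identified-copies reading HOLDS; and
`−|log(q)|(P♭) = stepVWeight · (−|log(q)|(P♯))` while `−|log(Θ)|(P♭) = −|log(Θ)|(P♯)`.  So, with both regions
pinned as printed, the typed premises do not decide `GapA″`: the ONE datum «which bad-place monoid the q-pilot's
Kummer image through the link is» does.  Naive `2`-adic model; interface/toy level; no side taken. [folklore] -/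
theorem cor312_pinned_fork_over_contentful_thm311 :
    ∃ (T : ThetaIndex) (F : FullSituation T)
      (ρ : (∀ v : T.V, v ∈ T.Vbad → Set (F.L.StarPacket v)) → ∀ (j : T.Label) (vQ : T.VQ), Set (F.L.Packet j vQ))
      (qKs qKf : ∀ v : T.V, v ∈ T.Vbad → Set (F.L.StarPacket v))
      (Ps Pf : Setting F.toLatticeSituation.toSituation),
      F.Statement ∧ F.MultiradialCompat ∧
      (∀ (n : ℤ) (v : T.V) (hv : v ∈ T.Vbad),
        ((F.D n).Ψ v hv).Nonempty ∧ (0 : F.L.StarPacket v) ∉ (F.D n).Ψ v hv) ∧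
      (∀ (n : ℤ) (j : T.LabelStar), ((F.D n).Mmod j).Nonempty) ∧
      (∀ (n : ℤ) (j : T.Label) (vQ : T.VQ) (m : ℤ), (F.col n).unitImage m 1 j vQ ⊂ (F.D n).shellPk j vQ) ∧
      (∀ n m : ℤ, ∃ a : F.link.AutHT n m, F.link.onDelta n m a ≠ CategoryTheory.Iso.refl _) ∧
      (∃ Φ ∈ Setting.indGroup F.toSituation, ∃ (j : T.Label) (vQ : T.VQ) (x : F.L.Packet j vQ), Φ j vQ x ≠ x) ∧
      (∀ Φ ∈ Subgroup.closure (F.L.Ind1Family ∪ F.L.Ind2Family),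
        ∀ (Ψ : ∀ v : T.V, v ∈ T.Vbad → Set (F.L.StarPacket v)) (j : T.Label) (vQ : T.VQ),
          ρ (fun v hv => F.L.starAut Φ v '' Ψ v hv) j vQ = Φ j vQ '' ρ Ψ j vQ) ∧
      (∃ (j : T.Label) (vQ : T.VQ), ρ qKs j vQ ≠ ρ qKf j vQ) ∧
      (Pf.n = Ps.n ∧ Pf.frame = Ps.frame ∧
        ∀ (m : ℤ) (j : T.Label) (vQ : T.VQ), Pf.thetaRegion m j vQ = Ps.thetaRegion m j vQ) ∧
      (PinnedRegions3 F.toLatticeSituation Ps ρ qKs ∧ ¬ PilotKummerIndRelated F.toLatticeSituation Ps ρ qKs ∧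
        ¬ GapA'' F.toLatticeSituation Ps ρ qKs ∧
        BridgeHyps Ps ∧ Ps.AbsLogQPos ∧ ¬ Ps.Statement ∧ ¬ Ps.IdentifiedReading ∧
          Ps.negLogTheta = ((stepVWeight T * Ps.negLogQ : ℝ) : WithTop ℝ)) ∧
      (PinnedRegions3 F.toLatticeSituation Pf ρ qKf ∧
        (∀ (m₀ : ℤ) (j : T.Label) (vQ : T.VQ), ρ qKf j vQ = ρ ((F.col (Pf.n - 1)).frobΨ m₀) j vQ) ∧
        PilotKummerIndRelated F.toLatticeSituation Pf ρ qKf ∧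
        GapA'' F.toLatticeSituation Pf ρ qKf ∧ BridgeHyps Pf ∧ Pf.AbsLogQPos ∧ Pf.Statement ∧
          Pf.IdentifiedReading ∧ Pf.negLogTheta = ((Pf.negLogQ : ℝ) : WithTop ℝ)) ∧
      Pf.negLogQ = stepVWeight T * Ps.negLogQ ∧ Pf.negLogTheta = Ps.negLogTheta := by
  haveI : Fact (Nat.Prime 2) := ⟨Nat.prime_two⟩
  refine ⟨toyIndex, naiveFull 2, ballOfMonoid 2, (fun v _ => qDatum 2 v), (fun v _ => Psi 2 v),
    honestQSetting 2, linkIdSetting 2, naiveFull_statement 2, naive_multiradialCompat 2,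
    fun n v hv => ⟨⟨thetaValues 2 v, thetaValues_mem_Psi 2 v⟩, zero_notMem_Psi 2 v⟩,
    fun _ _ => ⟨0, Set.mem_univ _⟩, fun n j vQ m => ?_, fun n m => ⟨(-1 : ℤˣ), unitIso_neg_one_ne_refl⟩,
    naive_indGroup_nontrivial 2, ballOfMonoid_equivariant 2, ⟨2, (), ?_⟩, ⟨rfl, rfl, fun _ _ _ => rfl⟩,
    ⟨honestQ_pinnedRegions3 2, honestQ_not_pilotKummerIndRelated 2, honestQ_not_gapA'' 2, withQDatum_bridgeHyps 2 _ _,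
      honestQ_absLogQPos 2, honestQ_not_statement 2, honestQ_not_identifiedReading 2, honestQ_encodes 2⟩,
    ⟨linkId_pinnedRegions3 2, linkId_hlink 2, linkId_pilotKummerIndRelated 2, linkId_gapA'' 2, linkId_bridgeHyps 2,
      linkId_absLogQPos 2, (linkId_statement_attained 2).1, linkId_reading 2, (linkId_statement_attained 2).2⟩,
    linkId_negLogQ_eq_weight_mul 2, ?_⟩
  · show pBall 2 j vQ ((1 : ℕ) + 1 : ℤ) ⊂ pBall 2 j vQ 0
    exact (pBall_succ_ssubset 2 j vQ 1).trans_subset (pBall_mono 2 j vQ (by norm_num))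
  · -- at `j = 2`: the honest datum generates `B_1`, the Θ-monoid `B_4`
    rw [ballOfMonoid_qDatum, ballOfMonoid_psi, if_neg (by decide)]
    intro h
    have hj : jsq (2 : toyIndex.Label) = 4 := by decide
    rw [hj] at h
    have := pBall_injective 2 2 () h
    omega
  · show (linkIdSetting 2).negLogTheta = (honestQSetting 2).negLogTheta
    rw [show (linkIdSetting 2).negLogTheta = _ from withQDatum_negLogTheta 2 _ (psi_hul 2),
      show (honestQSetting 2).negLogTheta = _ from withQDatum_negLogTheta 2 _ (qDatum_hul 2)]

/-- **GapA″ IS INDEPENDENT of typed Thm. 3.11 + pins + bridge hypotheses + `|log(q)| > 0`** (compact form of the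
fork, for the (G-PINNED) sentence): over one contentful `F` and one honest equivariant `ρ`, a pin-respecting setting
with `¬GapA″` and a pin-respecting setting with `GapA″ ∧ Statement` both exist. [folklore] -/
theorem pins_do_not_decide_gapA'' :
    ∃ (T : ThetaIndex) (F : FullSituation T)
      (ρ : (∀ v : T.V, v ∈ T.Vbad → Set (F.L.StarPacket v)) → ∀ (j : T.Label) (vQ : T.VQ), Set (F.L.Packet j vQ)),
      F.Statement ∧ (∀ (n : ℤ) (v : T.V) (hv : v ∈ T.Vbad), ((F.D n).Ψ v hv).Nonempty) ∧
      (∃ (qK : ∀ v : T.V, v ∈ T.Vbad → Set (F.L.StarPacket v)) (P : Setting F.toLatticeSituation.toSituation),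
        PinnedRegions F.toLatticeSituation P ρ qK ∧ BridgeHyps P ∧ P.AbsLogQPos ∧
          ¬ GapA'' F.toLatticeSituation P ρ qK ∧ ¬ P.Statement) ∧
      (∃ (qK : ∀ v : T.V, v ∈ T.Vbad → Set (F.L.StarPacket v)) (P : Setting F.toLatticeSituation.toSituation),
        PinnedRegions F.toLatticeSituation P ρ qK ∧ BridgeHyps P ∧ P.AbsLogQPos ∧
          GapA'' F.toLatticeSituation P ρ qK ∧ P.Statement) := by
  haveI : Fact (Nat.Prime 2) := ⟨Nat.prime_two⟩
  exact ⟨toyIndex, naiveFull 2, ballOfMonoid 2, naiveFull_statement 2,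
    fun _ v _ => ⟨thetaValues 2 v, thetaValues_mem_Psi 2 v⟩,
    ⟨_, honestQSetting 2, honestQ_pinnedRegions 2, withQDatum_bridgeHyps 2 _ _, honestQ_absLogQPos 2,
      honestQ_not_gapA'' 2, honestQ_not_statement 2⟩,
    ⟨_, linkIdSetting 2, linkId_pinnedRegions 2, linkId_bridgeHyps 2, linkId_absLogQPos 2, linkId_gapA'' 2,
      (linkId_statement_attained 2).1⟩⟩



end NaiveWitness

end Cor312Vol

end IUTFork

end Summit.ABC

end
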